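import Summits.BirchSwinnertonDyer.BirchSwinnertonDyer.Theorems.SchneiderFreeUpperSocketsSplit
import Summits.BirchSwinnertonDyer.BirchSwinnertonDyer.Theorems.SchneiderFreeAdditiveX3UpperWingPotMult
import HarnessLib

/-!
# Schneider-free additive X3 door, SECOND WING — the class-level glue RE-KEYED to the SPLIT twist-unit datum
# (co-chain at a GOOD member, unit at ANY member, only the FIELD shared; both cells; Theses-free)

Cell `bsd-schneider-ideate`, seat `bsd-schneider-door-c5` (prover, generation 9); sequel to generation 8's
`…UpperWingGord.lean` (p484119) / `…UpperWingPotMult.lean` (p485335), executing memo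
`memos/ROUTE-P2-upper-v2-g13.md` U34 (planner P2 gen 13): «replace the binder
`hTU : … → ∃ W₂ ∼ W, TwistUnitHeegnerDataAt W₂ p` by `hTU : … → Upper.TwistUnitFieldAt W p` … strictly weaker
hypothesis, same conclusion; on the no-unit-at-`E` classes the bundled `hTU` is unsatisfiable at every member
while the field datum is a finite certificate (1260j1 @3: `K = ℚ(√−311)`, `W₂ = m2`; 2394n1 @3).»

* §1 `missingUpperBoundAt_of_members` — the member-juggled descent (Sketch §7) in the tree's GZK currency.
* §2 `missingUpperBoundAt_of_goodMemberCoStepL_of_twistUnitField` — the per-curve assembly from the SPLIT datum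
  (Sketch §10 U33(a), same name): printed facts → `r_an = 1` → `p ≠ 2` → `p ∣ N_W` → `hGM` («for every
  imaginary quadratic Heegner `K` with `p ∤ d_K` some member `W₁ ∼ W` has `N_{W₁} = N_W`, `N10.Locus W₁ p`,
  `W₁(K)[p] = 0` and co-STEP L♯ at `W₁`») → `TwistUnitFieldAt W p` → `MissingUpperBoundAt W p`.
* §3 the co-chain member ON EACH CELL from Kolyvagin + the control corner's conclusion `hCtl` + the cell's
  co-socket `hCoG` / `hCoM` at KY-normalised curves (door-c4 gen 7's good / normalised member; modularity pays
  the conductor), and their union `coChainMember_sstTwist_of_coIMCs_of_control` = the body of the memo's derived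
  node `GoodMemberCoChainX3` (U33(b)), unfolded — the Prop itself is a route item for the director's U25 ruling
  and is NOT declared here.
* §4 the RE-KEYED glue: `missingUpperBoundAt_{gordTwo,potMult}_of_coIMC_of_control_of_twistUnitField`, the union
  `missingUpperBoundAt_sstTwist_of_coIMCs_of_control_of_twistUnitField`, and the two-crux form
  `missingUpperBoundAt_sstTwist_of_coChain_of_twistUnitField` (= the memo's
  `additiveX3RankOneUpper_of_goodMemberCoChain_of_twistUnitSplit` with the three Props unfolded).

HONEST FRAMING: CONDITIONAL on every displayed hypothesis (`hCoG` is preprint-bound, `hCoM` has NO print, `hTU`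
is a per-pair certificate / open class-wide); no rung leaf is registered for the wing; closes no item; BSD is
not advanced. No named fact is used silently (all are binders).
References: [JetchevSkinnerWan2017] §7.4.1; [GrossZagier1986] I.(6.3), (7.3); [Miller2011LMS] Def. 1.1;
[Cassels1965ArithmeticVIII]; [KellerYin2024b] arXiv:2410.23241 Thm. 3.5.1, §3.3 ¶1 (shape of `hCoG`; preprint);
[Mazur1978] Prop. 5.4; [Vatsal1999] Thm. 0.3 and [KrizLi2019] Thm. 1.20 (shape of `hTU`).
-/

noncomputable section

open scoped Classical

open WeierstrassCurve NumberField IsDedekindDomain Field Literature.NumberTheory.EllipticCurves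
  Literature.NumberTheory.EllipticCurves.ModularForms Literature.NumberTheory.EllipticCurves.GreenbergSelmer
  Literature.NumberTheory.EllipticCurves.Rank1Residual Literature.NumberTheory.EllipticCurves.Rank1Residual.Typed
  Literature.NumberTheory.GaloisRepresentations Literature.NumberTheory.EllipticCurves.KellerYin2024
  Summit.BirchSwinnertonDyer.Rank1Residual Summit.BirchSwinnertonDyer.Rank1Residual.Additive
  Summit.BirchSwinnertonDyer.Rank1Residual.X11b Summit.BirchSwinnertonDyer.Rank1Residual.X11b.AcSelmer
  Summit.BirchSwinnertonDyer.Rank1Residual.X11b.Halves Summit.BirchSwinnertonDyer.BirchSwinnertonDyer.Theorems.SchneiderFree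

set_option linter.dupNamespace false
set_option autoImplicit false

namespace Summit.BirchSwinnertonDyer.BirchSwinnertonDyer.Theorems.SchneiderFree.Upper

/-! ### §1 Member-juggled descent (GZK currency) -/

/-- **Member-juggled descent** (Sketch §7, GZK currency): the JOINT upper half at `(W₁, W₁d)` (analytic ranks
`≤ 1`), a member `W₂ ∼ W₁` with `W₁d ∼ W₂d` and `ord_p #Ш_an(W₂d) ≤ 0`, and Cassels give the UPPER half for every
globally minimal `W ∼ W₂`. [cite: Miller2011LMS, §1 and Def. 1.1] [cite: Cassels1965ArithmeticVIII] -/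
theorem missingUpperBoundAt_of_members {W W₁ W₂ W₁d W₂d : WeierstrassCurve ℚ} [W.IsElliptic]
    [W₁.IsElliptic] [W₂.IsElliptic] [W₁d.IsElliptic] [W₂d.IsElliptic] [W.IsGloballyMinimal]
    [W₁.IsGloballyMinimal] [W₂.IsGloballyMinimal] [W₁d.IsGloballyMinimal] [W₂d.IsGloballyMinimal] {p : ℕ}
    [Fact p.Prime] (hCassels : bsdRHS_eq_of_isIsogenous) (hGZK : rank_eq_analyticRank_of_analyticRank_le_one)
    (hmod : hasEntireLFunction_rat) (h12 : IsIsogenous W₁ W₂) (h12d : IsIsogenous W₁d W₂d)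
    (h2W : IsIsogenous W₂ W) (hr1 : W₁.analyticRank ≤ 1) (hrd1 : W₁d.analyticRank ≤ 1)
    (hr2 : W₂.analyticRank ≤ 1) (hJ : JointUpperBoundAt W₁ W₁d p)
    (hU : ∃ qd : ℚ, shaAn W₂d = (qd : ℂ) ∧ padicValRat p qd ≤ 0) : MissingUpperBoundAt W p :=
  TwistComparison.missingUpperBoundAt_of_isIsogenous W₂ W p hCassels hGZK hmod h2W hr2
    (missingUpperBoundAt_of_jointUpper_of_twistUnit
      (jointUpperBoundAt_of_isIsogenous hCassels hGZK hmod h12 h12d hr1 hrd1 hJ) hU)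

/-! ### §2 Per-curve assembly of the upper wing from the SPLIT datum (P2 gen 13 Sketch §10 U33(a)) -/

/-- **Per-curve assembly of the upper wing from the SPLIT datum (kernel-checked; Sketch §10 U33(a)).** Printed
facts + «for every imaginary quadratic Heegner field `K` of `N_W` with `p ∤ d_K` some member `W₁ ∼ W` runs the
co-chain: `N_{W₁} = N_W`, N10 locus, `W₁(K)[p] = 0`, co-STEP L♯ at `W₁`» + the split datum ⟹ `MissingUpperBoundAt W p`.
Route: `p ∤ d_K`, `p ∤ #𝓞_K^×` (`p ∣ N_W` Heegner-split); Heegner point at `W₁` (§2 of the sockets file) → co-STEP L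
→ JOINT upper at `(W₁, W₁d)` (`jointUpperBoundAt_of_coStepL_manin`) → §1 to `(W₂, W₂d)`, the unit, Cassels to `W`.
[cite: GrossZagier1986, Thm. I.(6.3) and (7.3)] [cite: Miller2011LMS, Def. 1.1] [cite: JetchevSkinnerWan2017, §7.4.1] -/
theorem missingUpperBoundAt_of_goodMemberCoStepL_of_twistUnitField
    (hGZ : ∀ (N : ℕ) [NeZero N] (W : WeierstrassCurve ℚ) (K : Type) [Field K] [NumberField K],
      gross_zagier N W K)
    (hKo : ∀ (N : ℕ) [NeZero N] (W : WeierstrassCurve ℚ) (K : Type) [Field K] [NumberField K],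
      kolyvagin N W K)
    (hGZK : rank_eq_analyticRank_of_analyticRank_le_one) (hmod : hasEntireLFunction_rat)
    (hGZ73 : GrossZagier1986_thm_I_7_3) (hCassels : bsdRHS_eq_of_isIsogenous)
    (hHP : ∀ (W : WeierstrassCurve ℚ) (K : Type) [Field K] [NumberField K], exists_isHeegnerPoint W K)
    (W : WeierstrassCurve ℚ) [W.IsElliptic] [W.IsGloballyMinimal] (p : ℕ) [Fact p.Prime]
    (hr : W.analyticRank = 1) (hp2 : p ≠ 2) (hpN : p ∣ W.conductorNorm ℤ)
    (hGM : ∀ (K : Type) [Field K] [NumberField K], IsImaginaryQuadratic K →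
      SatisfiesHeegnerHypothesis (W.conductorNorm ℤ) K → ¬ (p : ℤ) ∣ NumberField.discr K →
      ∃ (W₁ : WeierstrassCurve ℚ) (_ : W₁.IsElliptic) (_ : W₁.IsGloballyMinimal),
        IsIsogenous W W₁ ∧ W₁.conductorNorm ℤ = W.conductorNorm ℤ ∧ Additive.N10.Locus W₁ p ∧
        (∀ Q : (W₁.baseChange K).toAffine.Point, p • Q = 0 → Q = 0) ∧ AdditiveCoStepLInputManinAt W₁ p)
    (hT : TwistUnitFieldAt W p) : MissingUpperBoundAt W p := by
  obtain ⟨K, _, _, W₂, W₂d, _, _, _, _, hK, hodd, hHH, hLd, h2, ⟨C₂, hC₂⟩, hU⟩ := hT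
  obtain ⟨hpd, hw⟩ := X11b.Three.not_dvd_discr_and_not_dvd_torsionOrder_of_heegner hK hHH hp2 hpN
  obtain ⟨W₁, _, _, h1, hN1, hLoc1, htf1, hco1⟩ := hGM K hK hHH hpd
  have hD0 : (NumberField.discr K : ℚ) ≠ 0 := by exact_mod_cast NumberField.discr_ne_zero K
  haveI := W.isElliptic_quadraticTwist hD0
  haveI := W₁.isElliptic_quadraticTwist hD0
  haveI := W₂.isElliptic_quadraticTwist hD0
  -- the co-chain member: analytic rank one, Heegner hypothesis, `L(W₁^{d_K},1) ≠ 0` (all isogeny-invariant)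
  have hr1 : W₁.analyticRank = 1 := by rw [← analyticRank_eq_of_isIsogenous' h1]; exact hr
  have hHH1 : SatisfiesHeegnerHypothesis (W₁.conductorNorm ℤ) K := by rw [hN1]; exact hHH
  have hpN1 : p ∣ W₁.conductorNorm ℤ := by rw [hN1]; exact hpN
  have hLd1 : (W₁.quadraticTwist (NumberField.discr K : ℚ)).entireLFunction 1 ≠ 0 := by
    rw [← entireLFunction_eq_of_isIsogenous' (h1.quadraticTwist hD0)]; exact hLd
  -- its Heegner point (a theorem, not part of the datum)
  haveI hN0 : NeZero (W₁.conductorNorm ℤ) := ⟨W₁.conductorNorm_pos_holds.ne'⟩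
  obtain ⟨Dt, H, ι, P, hP, hnt⟩ :=
    exists_heegnerPoint_not_isOfFinAddOrder_of_twist_ne_zero hHP hGZ hmod W₁ (W₁.conductorNorm ℤ) K hr1 rfl hK
      hHH1 hLd1
  -- co-STEP L at the co-chain member, then the JOINT upper half at `(W₁, W₁d)`
  have hI : IndexUpperBoundLeAt W₁ p K P (padicValNat p Dt.c.natAbs) :=
    hco1 (W₁.conductorNorm ℤ) K Dt H ι P hr1 hLoc1 rfl hK hodd hw hHH1 hLd1 hP hnt htf1
  obtain ⟨C₁, hC₁⟩ := hasGlobalMinimalModel_rat_holds (W₁.quadraticTwist (NumberField.discr K : ℚ))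
  set W₁d : WeierstrassCurve ℚ := C₁ • W₁.quadraticTwist (NumberField.discr K : ℚ) with hW₁d_def
  haveI : W₁d.IsGloballyMinimal := hC₁
  have hW₁d : C₁ • W₁.quadraticTwist (NumberField.discr K : ℚ) = W₁d := rfl
  have hJ1 : JointUpperBoundAt W₁ W₁d p :=
    jointUpperBoundAt_of_coStepL_manin hGZ hKo hGZK hmod hGZ73 W₁ p (W₁.conductorNorm ℤ) K Dt H ι P W₁d hr1 rfl
      hpN1 hK hodd hw hHH1 hLd1 hP ⟨C₁, hW₁d⟩ hp2 hI
  -- isogenies between the members and between the twists' minimal models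
  have h12 : IsIsogenous W₁ W₂ := IsIsogenous.trans' h1.symm_of_isElliptic h2
  have h12d : IsIsogenous W₁d W₂d := by
    rw [← hW₁d, ← hC₂]
    exact IsIsogenous.trans' (IsIsogenous.trans' (isIsogenous_of_smul _ C₁) (h12.quadraticTwist hD0))
      (isIsogenous_smul _ C₂)
  -- analytic ranks `≤ 1` for the GZK transports
  have hrd1 : W₁d.analyticRank ≤ 1 := by
    have h0 : (W₁.quadraticTwist (NumberField.discr K : ℚ)).analyticRank = 0 :=
      ((W₁.quadraticTwist _).analyticRank_eq_zero_iff_holds (hmod _)).2 hLd1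
    rw [← hW₁d, analyticRank_smul, h0]; exact zero_le_one
  have hr2 : W₂.analyticRank ≤ 1 := by rw [← analyticRank_eq_of_isIsogenous' h2, hr]
  exact missingUpperBoundAt_of_members hCassels hGZK hmod h12 h12d h2.symm_of_isElliptic hr1.le hrd1 hr2 hJ1 hU

/-! ### §3 The co-chain member on each cell from Kolyvagin + the control corner + the cell's co-socket -/

/-- **Co-chain member on the (G-ord, `e = 2`) cell.** For `(W, p)` on the cell and an imaginary quadratic `K`
with `p ∤ d_K`: door-c4 gen 7's GOOD member `W₁ ∼ W` (rational `p`-line not fixed by `D_p`, `W₁(K)[p] = 0`;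
modularity pays `N_{W₁} = N_W`) lies on the cell with `r_an(W₁) = 1`, and co-STEP L♯ holds at `W₁` from the co-socket
`hCo`, the control input `hCtl` and Kolyvagin (`additiveCoStepLInputManinAt_of_kolyvagin_of_control_of_imcUpper`).
[cite: KellerYin2024b, §3.3 ¶1 (arXiv:2410.23241 p. 14)] [cite: Mazur1978, Prop. 5.4] [cite: JetchevSkinnerWan2017, §7.4.1] -/
theorem coChainMember_gordTwo_of_coIMC_of_control
    (hKo : ∀ (N : ℕ) [NeZero N] (W : WeierstrassCurve ℚ) (K : Type) [Field K] [NumberField K],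
      kolyvagin N W K)
    (hPar : nonempty_modularParametrizationData)
    (hCtl : ∀ (W : WeierstrassCurve ℚ) [W.IsElliptic] [W.IsGloballyMinimal] (p : ℕ) [Fact p.Prime],
      W.analyticRank = 1 → p ≠ 2 → ClassX3 W p → Additive.SubSemistableTwist W p →
      AdditiveControlInputManinAt W p)
    (hCo : ∀ (W : WeierstrassCurve ℚ) [W.IsElliptic] [W.IsGloballyMinimal] (p : ℕ) [Fact p.Prime],
      p ≠ 2 → ClassX3 W p → Additive.SubGordTwo W p →
      (∃ Φ : AddSubgroup (geomTorsion W (p : ℤ)), IsRationalLine W p Φ ∧ ¬ LineDecompositionTrivialAt W p Φ) →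
      AdditiveIMCUpperBDPInputManinAt W p)
    (W : WeierstrassCurve ℚ) [W.IsElliptic] [W.IsGloballyMinimal] (p : ℕ) [Fact p.Prime]
    (hr : W.analyticRank = 1) (hp2 : p ≠ 2) (hX : ClassX3 W p) (hS : Additive.SubGordTwo W p)
    (K : Type) [Field K] [NumberField K] (hK : IsImaginaryQuadratic K)
    (hpd : ¬ (p : ℤ) ∣ NumberField.discr K) :
    ∃ (W₁ : WeierstrassCurve ℚ) (_ : W₁.IsElliptic) (_ : W₁.IsGloballyMinimal),
      IsIsogenous W W₁ ∧ W₁.conductorNorm ℤ = W.conductorNorm ℤ ∧ Additive.N10.Locus W₁ p ∧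
      (∀ Q : (W₁.baseChange K).toAffine.Point, p • Q = 0 → Q = 0) ∧ AdditiveCoStepLInputManinAt W₁ p := by
  have hp : p.Prime := Fact.out
  obtain ⟨W₁, hE₁, hmin₁, φ, m, -, -, hN₁, -, hred₁, hlat₁, htf₁⟩ :=
    GoodMember.exists_goodMember_of_modularParametrization hPar hp2 W hX hS K hK.1 hpd
  have hiso₁ : IsIsogenous W₁ W := ⟨φ⟩
  have hiso₁' : IsIsogenous W W₁ := hiso₁.symm_of_isElliptic
  -- `W₁` lies on the cell, with `r_an(W₁) = 1`
  have hG : TypeG W p := (subGord_iff_typeG_of_addv W p hp2 hX.2).mp hS.1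
  have hadd₁ : Addv W₁ p := Addv.of_isIsogenous_of_typeG hX.2 hG hiso₁'
  have hSG₁ : SubGord W₁ p := (subGord_iff_of_isIsogenous hp2 hX.2 hiso₁').mp hS.1
  have he₁ : semistabilityIndex W₁ p = 2 :=
    (semistabilityIndex_eq_of_isIsogenous_of_typeG_of_addv hp2 hX.2 hG hiso₁').trans hS.2
  have hX₁ : ClassX3 W₁ p := ⟨hred₁, hadd₁⟩
  have hS₁ : Additive.SubGordTwo W₁ p := ⟨hSG₁, he₁⟩
  have hr₁ : W₁.analyticRank = 1 := by rw [analyticRank_eq_of_isIsogenous' hiso₁, hr]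
  have hloc₁ : Additive.N10.Locus W₁ p :=
    (Additive.N10.locus_iff_cells W₁ p).mpr
      ((Additive.N10.cellM_or_cellGordTwo_of_classX3_of_subSemistableTwist W₁ p hp2 hX₁ (Or.inr hS₁)).elim
        Or.inl (fun h ↦ Or.inr (Or.inl h)))
  -- co-STEP L♯ at `W₁`: co-socket at the good member + control + Kolyvagin
  have hco : AdditiveCoStepLInputManinAt W₁ p :=
    additiveCoStepLInputManinAt_of_kolyvagin_of_control_of_imcUpper (fun N _ K _ _ ↦ hKo N W₁ K)
      (hCtl W₁ p hr₁ hp2 hX₁ (Or.inr hS₁)) (hCo W₁ p hp2 hX₁ hS₁ hlat₁)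
  exact ⟨W₁, hE₁, hmin₁, hiso₁', hN₁, hloc₁, htf₁, hco⟩

/-- **Co-chain member on the (M) cell** (the twin): door-c4 gen 7's NORMALISED member `exists_member_uniqueLine`
(`W₁(K)[p] = 0` by `forall_baseChange_nsmul_eq_zero`) stays on (M) (`subM_of_isIsogenous`), `N_{W₁} = N_W` by
modularity; co-STEP L♯ at `W₁` from `hCo`, `hCtl`, Kolyvagin. [cite: Mazur1978, Prop. 5.4] [cite: JetchevSkinnerWan2017, §7.4.1] -/
theorem coChainMember_potMult_of_coIMC_of_control
    (hKo : ∀ (N : ℕ) [NeZero N] (W : WeierstrassCurve ℚ) (K : Type) [Field K] [NumberField K],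
      kolyvagin N W K)
    (hPar : nonempty_modularParametrizationData)
    (hCtl : ∀ (W : WeierstrassCurve ℚ) [W.IsElliptic] [W.IsGloballyMinimal] (p : ℕ) [Fact p.Prime],
      W.analyticRank = 1 → p ≠ 2 → ClassX3 W p → Additive.SubSemistableTwist W p →
      AdditiveControlInputManinAt W p)
    (hCo : ∀ (W : WeierstrassCurve ℚ) [W.IsElliptic] [W.IsGloballyMinimal] (p : ℕ) [Fact p.Prime],
      p ≠ 2 → ClassX3 W p → Additive.SubM W p →
      (∃ Φ : AddSubgroup (geomTorsion W (p : ℤ)), IsRationalLine W p Φ ∧ ¬ LineDecompositionTrivialAt W p Φ) →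
      AdditiveIMCUpperBDPInputManinAt W p)
    (W : WeierstrassCurve ℚ) [W.IsElliptic] [W.IsGloballyMinimal] (p : ℕ) [Fact p.Prime]
    (hr : W.analyticRank = 1) (hp2 : p ≠ 2) (hX : ClassX3 W p) (hS : Additive.SubM W p)
    (K : Type) [Field K] [NumberField K] (hK : IsImaginaryQuadratic K)
    (hpd : ¬ (p : ℤ) ∣ NumberField.discr K) :
    ∃ (W₁ : WeierstrassCurve ℚ) (_ : W₁.IsElliptic) (_ : W₁.IsGloballyMinimal),
      IsIsogenous W W₁ ∧ W₁.conductorNorm ℤ = W.conductorNorm ℤ ∧ Additive.N10.Locus W₁ p ∧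
      (∀ Q : (W₁.baseChange K).toAffine.Point, p • Q = 0 → Q = 0) ∧ AdditiveCoStepLInputManinAt W₁ p := by
  have hp : p.Prime := Fact.out
  obtain ⟨Φ₀, hΦ₀⟩ := exists_isRationalLine_of_not_irr (W := W) (p := p) hX.1
  obtain ⟨W₁, hE₁, hmin₁, g, k, L, -, hL, huniq, hn1, hn2, hn3⟩ :=
    GoodMember.exists_member_uniqueLine (V := W) hp2 hΦ₀ hpd
  have hiso₁' : IsIsogenous W W₁ := ⟨g⟩
  have hiso₁ : IsIsogenous W₁ W := hiso₁'.symm_of_isElliptic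
  have htf₁ : ∀ Q : (W₁.baseChange K).toAffine.Point, p • Q = 0 → Q = 0 :=
    fun Q hQ ↦ GoodMember.forall_baseChange_nsmul_eq_zero hp2 huniq hn1 hK.1 hpd hn2 Q hQ
  have hlat₁ : ∃ Φ : AddSubgroup (geomTorsion W₁ (p : ℤ)),
      IsRationalLine W₁ p Φ ∧ ¬ LineDecompositionTrivialAt W₁ p Φ := ⟨L, hL, hn3⟩
  have hN₁ : W₁.conductorNorm ℤ = W.conductorNorm ℤ :=
    GoodMember.conductorNorm_eq_of_isIsogenous_of_modularParametrization hPar W W₁ hiso₁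
  -- `W₁` lies on the (M) cell, with `r_an(W₁) = 1`
  have hadd₁ : Addv W₁ p := addv_of_isIsogenous hX.2 hiso₁'
  have hM₁ : Additive.SubM W₁ p := subM_of_isIsogenous hp2 hX.2 hS hiso₁'
  have hX₁ : ClassX3 W₁ p := ⟨red_of_isRationalLine hL, hadd₁⟩
  have hr₁ : W₁.analyticRank = 1 := by rw [analyticRank_eq_of_isIsogenous' hiso₁, hr]
  have hloc₁ : Additive.N10.Locus W₁ p :=
    (Additive.N10.locus_iff_cells W₁ p).mpr
      ((Additive.N10.cellM_or_cellGordTwo_of_classX3_of_subSemistableTwist W₁ p hp2 hX₁ (Or.inl hM₁)).elim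
        Or.inl (fun h ↦ Or.inr (Or.inl h)))
  -- co-STEP L♯ at `W₁`: co-socket at the normalised member + control + Kolyvagin
  have hco : AdditiveCoStepLInputManinAt W₁ p :=
    additiveCoStepLInputManinAt_of_kolyvagin_of_control_of_imcUpper (fun N _ K _ _ ↦ hKo N W₁ K)
      (hCtl W₁ p hr₁ hp2 hX₁ (Or.inl hM₁)) (hCo W₁ p hp2 hX₁ hM₁ hlat₁)
  exact ⟨W₁, hE₁, hmin₁, hiso₁', hN₁, hloc₁, htf₁, hco⟩

/-- **Co-chain member on the whole door (B6 ∩ X3 ∩ sst-twist)** — the body of the memo's derived node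
`GoodMemberCoChainX3` (U33(b)) from Kolyvagin, modularity, the control conclusion `hCtl` and the two co-sockets
`hCoG` / `hCoM`; the Prop itself is not declared here (route item on the director's ruling).
[cite: KellerYin2024b, §3.3 ¶1 (arXiv:2410.23241 p. 14)] [cite: Mazur1978, Prop. 5.4] [cite: JetchevSkinnerWan2017, §7.4.1] -/
theorem coChainMember_sstTwist_of_coIMCs_of_control
    (hKo : ∀ (N : ℕ) [NeZero N] (W : WeierstrassCurve ℚ) (K : Type) [Field K] [NumberField K],
      kolyvagin N W K)
    (hPar : nonempty_modularParametrizationData)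
    (hCtl : ∀ (W : WeierstrassCurve ℚ) [W.IsElliptic] [W.IsGloballyMinimal] (p : ℕ) [Fact p.Prime],
      W.analyticRank = 1 → p ≠ 2 → ClassX3 W p → Additive.SubSemistableTwist W p →
      AdditiveControlInputManinAt W p)
    (hCoG : ∀ (W : WeierstrassCurve ℚ) [W.IsElliptic] [W.IsGloballyMinimal] (p : ℕ) [Fact p.Prime],
      p ≠ 2 → ClassX3 W p → Additive.SubGordTwo W p →
      (∃ Φ : AddSubgroup (geomTorsion W (p : ℤ)), IsRationalLine W p Φ ∧ ¬ LineDecompositionTrivialAt W p Φ) →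
      AdditiveIMCUpperBDPInputManinAt W p)
    (hCoM : ∀ (W : WeierstrassCurve ℚ) [W.IsElliptic] [W.IsGloballyMinimal] (p : ℕ) [Fact p.Prime],
      p ≠ 2 → ClassX3 W p → Additive.SubM W p →
      (∃ Φ : AddSubgroup (geomTorsion W (p : ℤ)), IsRationalLine W p Φ ∧ ¬ LineDecompositionTrivialAt W p Φ) →
      AdditiveIMCUpperBDPInputManinAt W p) :
    ∀ (W : WeierstrassCurve ℚ) [W.IsElliptic] [W.IsGloballyMinimal] (p : ℕ) [Fact p.Prime],
      W.analyticRank = 1 → p ≠ 2 → ClassX3 W p → Additive.SubSemistableTwist W p →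
      ∀ (K : Type) [Field K] [NumberField K], IsImaginaryQuadratic K →
        SatisfiesHeegnerHypothesis (W.conductorNorm ℤ) K → ¬ (p : ℤ) ∣ NumberField.discr K →
        ∃ (W₁ : WeierstrassCurve ℚ) (_ : W₁.IsElliptic) (_ : W₁.IsGloballyMinimal),
          IsIsogenous W W₁ ∧ W₁.conductorNorm ℤ = W.conductorNorm ℤ ∧ Additive.N10.Locus W₁ p ∧
          (∀ Q : (W₁.baseChange K).toAffine.Point, p • Q = 0 → Q = 0) ∧ AdditiveCoStepLInputManinAt W₁ p := by
  intro W _ _ p _ hr hp2 hX hS K _ _ hK _ hpd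
  rcases hS with hM | hGo
  · exact coChainMember_potMult_of_coIMC_of_control hKo hPar hCtl hCoM W p hr hp2 hX hM K hK hpd
  · exact coChainMember_gordTwo_of_coIMC_of_control hKo hPar hCtl hCoG W p hr hp2 hX hGo K hK hpd

/-! ### §4 The RE-KEYED glue: the UPPER half on each cell and on the door from the SPLIT twist-unit datum (U34) -/

/-- **The second wing on the (G-ord, `e = 2`) cell, SPLIT datum** — generation 8's `…gordTwo_of_coIMC_of_control_of_twistUnitMember`
with `hTU` WEAKENED to the field datum `TwistUnitFieldAt W p` (memo U34: the unit member's point / torsion clause /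
parametrisation datum were never used). CONDITIONAL on every displayed hypothesis; registers/closes nothing; BSD
not advanced. [cite: JetchevSkinnerWan2017, §7.4.1] [cite: KellerYin2024b, Thm. 3.5.1 (preprint; shape of hCo)] [cite: KrizLi2019, Thm. 1.20] -/
theorem missingUpperBoundAt_gordTwo_of_coIMC_of_control_of_twistUnitField
    (hGZ : ∀ (N : ℕ) [NeZero N] (W : WeierstrassCurve ℚ) (K : Type) [Field K] [NumberField K],
      gross_zagier N W K)
    (hKo : ∀ (N : ℕ) [NeZero N] (W : WeierstrassCurve ℚ) (K : Type) [Field K] [NumberField K],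
      kolyvagin N W K)
    (hGZK : rank_eq_analyticRank_of_analyticRank_le_one) (hmod : hasEntireLFunction_rat)
    (hPar : nonempty_modularParametrizationData) (hGZ73 : GrossZagier1986_thm_I_7_3)
    (hCassels : bsdRHS_eq_of_isIsogenous)
    (hHP : ∀ (W : WeierstrassCurve ℚ) (K : Type) [Field K] [NumberField K], exists_isHeegnerPoint W K)
    (hCtl : ∀ (W : WeierstrassCurve ℚ) [W.IsElliptic] [W.IsGloballyMinimal] (p : ℕ) [Fact p.Prime],
      W.analyticRank = 1 → p ≠ 2 → ClassX3 W p → Additive.SubSemistableTwist W p →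
      AdditiveControlInputManinAt W p)
    (hCo : ∀ (W : WeierstrassCurve ℚ) [W.IsElliptic] [W.IsGloballyMinimal] (p : ℕ) [Fact p.Prime],
      p ≠ 2 → ClassX3 W p → Additive.SubGordTwo W p →
      (∃ Φ : AddSubgroup (geomTorsion W (p : ℤ)), IsRationalLine W p Φ ∧ ¬ LineDecompositionTrivialAt W p Φ) →
      AdditiveIMCUpperBDPInputManinAt W p)
    (hTU : ∀ (W : WeierstrassCurve ℚ) [W.IsElliptic] [W.IsGloballyMinimal] (p : ℕ) [Fact p.Prime],
      W.analyticRank = 1 → p ≠ 2 → ClassX3 W p → Additive.SubGordTwo W p → TwistUnitFieldAt W p) :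
    ∀ (W : WeierstrassCurve ℚ) [W.IsElliptic] [W.IsGloballyMinimal] (p : ℕ) [Fact p.Prime],
      W.analyticRank = 1 → p ≠ 2 → ClassX3 W p → Additive.SubGordTwo W p → MissingUpperBoundAt W p := by
  intro W _ _ p _ hr hp2 hX hS
  have hpN : p ∣ W.conductorNorm ℤ := (W.dvd_conductorNorm_iff_not_hasGoodReductionAtPrime p).mpr hX.2.1
  exact missingUpperBoundAt_of_goodMemberCoStepL_of_twistUnitField hGZ hKo hGZK hmod hGZ73 hCassels hHP W p hr
    hp2 hpN (fun K _ _ hK _ hpd ↦ coChainMember_gordTwo_of_coIMC_of_control hKo hPar hCtl hCo W p hr hp2 hX hS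
      K hK hpd) (hTU W p hr hp2 hX hS)

/-- **The second wing on the (M) cell, SPLIT datum** — generation 8's `…potMult_of_coIMC_of_control_of_twistUnitMember`
with `hTU` WEAKENED to `TwistUnitFieldAt W p` (memo U34). CONDITIONAL on every displayed hypothesis (`hCo` on (M)
has NO print); registers/closes nothing; BSD is not advanced. [cite: JetchevSkinnerWan2017, §7.4.1]
[cite: Miller2011LMS, Def. 1.1] [cite: KrizLi2019, Thm. 1.20 (shape of hTU)] -/
theorem missingUpperBoundAt_potMult_of_coIMC_of_control_of_twistUnitField
    (hGZ : ∀ (N : ℕ) [NeZero N] (W : WeierstrassCurve ℚ) (K : Type) [Field K] [NumberField K],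
      gross_zagier N W K)
    (hKo : ∀ (N : ℕ) [NeZero N] (W : WeierstrassCurve ℚ) (K : Type) [Field K] [NumberField K],
      kolyvagin N W K)
    (hGZK : rank_eq_analyticRank_of_analyticRank_le_one) (hmod : hasEntireLFunction_rat)
    (hPar : nonempty_modularParametrizationData) (hGZ73 : GrossZagier1986_thm_I_7_3)
    (hCassels : bsdRHS_eq_of_isIsogenous)
    (hHP : ∀ (W : WeierstrassCurve ℚ) (K : Type) [Field K] [NumberField K], exists_isHeegnerPoint W K)
    (hCtl : ∀ (W : WeierstrassCurve ℚ) [W.IsElliptic] [W.IsGloballyMinimal] (p : ℕ) [Fact p.Prime],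
      W.analyticRank = 1 → p ≠ 2 → ClassX3 W p → Additive.SubSemistableTwist W p →
      AdditiveControlInputManinAt W p)
    (hCo : ∀ (W : WeierstrassCurve ℚ) [W.IsElliptic] [W.IsGloballyMinimal] (p : ℕ) [Fact p.Prime],
      p ≠ 2 → ClassX3 W p → Additive.SubM W p →
      (∃ Φ : AddSubgroup (geomTorsion W (p : ℤ)), IsRationalLine W p Φ ∧ ¬ LineDecompositionTrivialAt W p Φ) →
      AdditiveIMCUpperBDPInputManinAt W p)
    (hTU : ∀ (W : WeierstrassCurve ℚ) [W.IsElliptic] [W.IsGloballyMinimal] (p : ℕ) [Fact p.Prime],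
      W.analyticRank = 1 → p ≠ 2 → ClassX3 W p → Additive.SubM W p → TwistUnitFieldAt W p) :
    ∀ (W : WeierstrassCurve ℚ) [W.IsElliptic] [W.IsGloballyMinimal] (p : ℕ) [Fact p.Prime],
      W.analyticRank = 1 → p ≠ 2 → ClassX3 W p → Additive.SubM W p → MissingUpperBoundAt W p := by
  intro W _ _ p _ hr hp2 hX hS
  have hpN : p ∣ W.conductorNorm ℤ := (W.dvd_conductorNorm_iff_not_hasGoodReductionAtPrime p).mpr hX.2.1
  exact missingUpperBoundAt_of_goodMemberCoStepL_of_twistUnitField hGZ hKo hGZK hmod hGZ73 hCassels hHP W p hr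
    hp2 hpN (fun K _ _ hK _ hpd ↦ coChainMember_potMult_of_coIMC_of_control hKo hPar hCtl hCo W p hr hp2 hX hS
      K hK hpd) (hTU W p hr hp2 hX hS)

/-- **The second wing on the whole door (B6 ∩ X3 ∩ sst-twist) from TWO inputs, SPLIT form** — the memo's
`additiveX3RankOneUpper_of_goodMemberCoChain_of_twistUnitSplit` (U33(b)) with the Props `GoodMemberCoChainX3`,
`TwistUnitX3Split`, `AdditiveX3RankOneUpper` UNFOLDED as binders / conclusion (they are route items for the
director's ruling, not declared in the tree): printed facts → `hG` (some member runs the co-chain over every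
imaginary quadratic Heegner field with `p ∤ d_K`) → `hT` (the split twist-unit datum on the cell) → the UPPER half
on the cell. CONDITIONAL on `hG`, `hT`; registers/closes nothing; BSD is not advanced. [cite: Miller2011LMS, Def. 1.1] -/
theorem missingUpperBoundAt_sstTwist_of_coChain_of_twistUnitField
    (hGZ : ∀ (N : ℕ) [NeZero N] (W : WeierstrassCurve ℚ) (K : Type) [Field K] [NumberField K],
      gross_zagier N W K)
    (hKo : ∀ (N : ℕ) [NeZero N] (W : WeierstrassCurve ℚ) (K : Type) [Field K] [NumberField K],
      kolyvagin N W K)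
    (hGZK : rank_eq_analyticRank_of_analyticRank_le_one) (hmod : hasEntireLFunction_rat)
    (hGZ73 : GrossZagier1986_thm_I_7_3) (hCassels : bsdRHS_eq_of_isIsogenous)
    (hHP : ∀ (W : WeierstrassCurve ℚ) (K : Type) [Field K] [NumberField K], exists_isHeegnerPoint W K)
    (hG : ∀ (W : WeierstrassCurve ℚ) [W.IsElliptic] [W.IsGloballyMinimal] (p : ℕ) [Fact p.Prime],
      W.analyticRank = 1 → p ≠ 2 → ClassX3 W p → Additive.SubSemistableTwist W p →
      ∀ (K : Type) [Field K] [NumberField K], IsImaginaryQuadratic K →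
        SatisfiesHeegnerHypothesis (W.conductorNorm ℤ) K → ¬ (p : ℤ) ∣ NumberField.discr K →
        ∃ (W₁ : WeierstrassCurve ℚ) (_ : W₁.IsElliptic) (_ : W₁.IsGloballyMinimal),
          IsIsogenous W W₁ ∧ W₁.conductorNorm ℤ = W.conductorNorm ℤ ∧ Additive.N10.Locus W₁ p ∧
          (∀ Q : (W₁.baseChange K).toAffine.Point, p • Q = 0 → Q = 0) ∧ AdditiveCoStepLInputManinAt W₁ p)
    (hT : ∀ (W : WeierstrassCurve ℚ) [W.IsElliptic] [W.IsGloballyMinimal] (p : ℕ) [Fact p.Prime],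
      W.analyticRank = 1 → p ≠ 2 → ClassX3 W p → Additive.SubSemistableTwist W p → TwistUnitFieldAt W p) :
    ∀ (W : WeierstrassCurve ℚ) [W.IsElliptic] [W.IsGloballyMinimal] (p : ℕ) [Fact p.Prime],
      W.analyticRank = 1 → p ≠ 2 → ClassX3 W p → Additive.SubSemistableTwist W p →
      MissingUpperBoundAt W p := by
  intro W _ _ p _ hr hp2 hX hS
  have hpN : p ∣ W.conductorNorm ℤ := (W.dvd_conductorNorm_iff_not_hasGoodReductionAtPrime p).mpr hX.2.1
  exact missingUpperBoundAt_of_goodMemberCoStepL_of_twistUnitField hGZ hKo hGZK hmod hGZ73 hCassels hHP W p hr hp2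
    hpN (fun K _ _ hK hHH hpd ↦ hG W p hr hp2 hX hS K hK hHH hpd) (hT W p hr hp2 hX hS)

/-- **The second wing on the whole door from the wing's THREE typed inputs, SPLIT form** (U34): printed facts,
the control corner's conclusion `hCtl` (items 19295/19548), the co-sockets `hCoG` / `hCoM` at KY-normalised
curves of each cell, and the split twist-unit datum `hTU` on the cell ⟹ the UPPER half
`ord_p #Ш(E) ≤ ord_p #Ш(E)_an` on B6 ∩ X3 ∩ sst-twist in analytic rank one (both cells). CONDITIONAL on every
displayed hypothesis; registers/closes nothing; BSD is not advanced. [cite: JetchevSkinnerWan2017, §7.4.1]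
[cite: Miller2011LMS, Def. 1.1] [cite: KellerYin2024b, Thm. 3.5.1 (arXiv:2410.23241 p. 20) (preprint)] [cite: KrizLi2019, Thm. 1.20] -/
theorem missingUpperBoundAt_sstTwist_of_coIMCs_of_control_of_twistUnitField
    (hGZ : ∀ (N : ℕ) [NeZero N] (W : WeierstrassCurve ℚ) (K : Type) [Field K] [NumberField K],
      gross_zagier N W K)
    (hKo : ∀ (N : ℕ) [NeZero N] (W : WeierstrassCurve ℚ) (K : Type) [Field K] [NumberField K],
      kolyvagin N W K)
    (hGZK : rank_eq_analyticRank_of_analyticRank_le_one) (hmod : hasEntireLFunction_rat)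
    (hPar : nonempty_modularParametrizationData) (hGZ73 : GrossZagier1986_thm_I_7_3)
    (hCassels : bsdRHS_eq_of_isIsogenous)
    (hHP : ∀ (W : WeierstrassCurve ℚ) (K : Type) [Field K] [NumberField K], exists_isHeegnerPoint W K)
    (hCtl : ∀ (W : WeierstrassCurve ℚ) [W.IsElliptic] [W.IsGloballyMinimal] (p : ℕ) [Fact p.Prime],
      W.analyticRank = 1 → p ≠ 2 → ClassX3 W p → Additive.SubSemistableTwist W p →
      AdditiveControlInputManinAt W p)
    (hCoG : ∀ (W : WeierstrassCurve ℚ) [W.IsElliptic] [W.IsGloballyMinimal] (p : ℕ) [Fact p.Prime],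
      p ≠ 2 → ClassX3 W p → Additive.SubGordTwo W p →
      (∃ Φ : AddSubgroup (geomTorsion W (p : ℤ)), IsRationalLine W p Φ ∧ ¬ LineDecompositionTrivialAt W p Φ) →
      AdditiveIMCUpperBDPInputManinAt W p)
    (hCoM : ∀ (W : WeierstrassCurve ℚ) [W.IsElliptic] [W.IsGloballyMinimal] (p : ℕ) [Fact p.Prime],
      p ≠ 2 → ClassX3 W p → Additive.SubM W p →
      (∃ Φ : AddSubgroup (geomTorsion W (p : ℤ)), IsRationalLine W p Φ ∧ ¬ LineDecompositionTrivialAt W p Φ) →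
      AdditiveIMCUpperBDPInputManinAt W p)
    (hTU : ∀ (W : WeierstrassCurve ℚ) [W.IsElliptic] [W.IsGloballyMinimal] (p : ℕ) [Fact p.Prime],
      W.analyticRank = 1 → p ≠ 2 → ClassX3 W p → Additive.SubSemistableTwist W p → TwistUnitFieldAt W p) :
    ∀ (W : WeierstrassCurve ℚ) [W.IsElliptic] [W.IsGloballyMinimal] (p : ℕ) [Fact p.Prime],
      W.analyticRank = 1 → p ≠ 2 → ClassX3 W p → Additive.SubSemistableTwist W p →
      MissingUpperBoundAt W p :=
  missingUpperBoundAt_sstTwist_of_coChain_of_twistUnitField hGZ hKo hGZK hmod hGZ73 hCassels hHP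
    (coChainMember_sstTwist_of_coIMCs_of_control hKo hPar hCtl hCoG hCoM) hTU

end Summit.BirchSwinnertonDyer.BirchSwinnertonDyer.Theorems.SchneiderFree.Upper

end
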